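import Summits.QuantumFields.BalabanUV.Beta.GAN24.MonotoneTraceNorm
import Summits.QuantumFields.BalabanUV.Beta.GAN24.MonotoneLimit
import Summits.QuantumFields.BalabanUV.T4Continuum.Support.NE7PairwiseMonotone

/-!
# NE7LoewnerDiagramBV — row NE7 (node U5), route «PAIR-CAUCHY» ∕ supplier LÖW (ROUTES-NE7.md §L2.2 B3): the
# DIAGRAM-BV LEMMA — along a LÖWNER CHAIN of PSD kernels on a finite index set every entry, and every DIAGRAM
# functional (vertex-weighted sum of products of entries along the edges of a finite multigraph), has SUMMABLE
# INCREMENTS with an explicit total-variation bound; hence a NULL TAIL MODULUS with no rate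

Cell `pub-balaban`, rung (B)+1 sub-cell t4, lineage `b2b-balaban-t4-ne7-p2` (CRUX PROVER NE7 #2 under the
coordinator ruling «YM redirect», 2026-08-21; generation 52; route texts `HOME/t4/ROUTES-NE7.md` v3.8 §L2.2 B3
«PSD OFF-DIAGONAL BOUND ⇒ BV OF DIAGRAMS — ELEMENTARY-UNPROVED (2×2 minors) … LEMMA (to prove, M)» and B4,
`HOME/t4/b2b-balaban-t4-ne7-p2/g51/ROUTE2-NE7-P2.md` v1.6 §2 T.5♭ («the two rate-free producers of c₀: (α) BV in
the depth …») and §5 item 3 («remaining LÖW items = … the diagram-BV lemma»), `Support/NE7LoewnerJensen` header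
«NOT DELIVERED: … the diagram-BV lemma»).  HONEST FRAMING (page 1): FIXED FINITE T⁴, rung (B)+1 = existence AND
uniqueness of the `ε = L^{−K} → 0` limit of unit-scale averaged expectations, CONDITIONAL on BetaPertH and the
nine spine estimates (0/9 proved); NOT infinite volume, NOT a mass gap, NOT the Clay problem.  NE7 is NOT PRINTED
in [Balaban1984PropagatorsI]–[Balaban1989LargeFieldII] and NOT proved here.  Everything below is [folklore]
finite-dimensional linear algebra and real analysis over HYPOTHESIS SHAPES (an abstract chain of complex matrices);
one definition (`diagram`, our bookkeeping object), no cite tag, nothing printed asserted, no `sorry`.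

WHY.  Route LÖW (idea-2, §L2.2) converts PRINTED one-run, depth-uniform bounds on Bałaban's effective Gaussian
operators into two-depth moduli WITHOUT a rate: Jensen under linear block averaging makes the unit-lattice
operators Löwner-MONOTONE in the depth (B1; kernel faces `NE7LoewnerJensen.jensen_blockAvg_dim1`,
`B5AverageCurlStokes.sum_normSq_plaq_QvOp_le`, `Beta/GAN24/MonotoneTorusPlaquette.plaqCov_antitone` per
E-L2-g4-1), the covariances Löwner-ANTITONE and bounded (B2).  B3 is the step from ENTRIES to DIAGRAMS: a
Gaussian-sector coefficient is (by Wick) a finite sum `F(C) = Σ_x w(x)·Π_e C(x_{s(e)}, x_{t(e)})` over vertex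
positions of products of covariance entries along the edges of a multigraph, with bounded local vertex weights
`w`; along a Löwner chain `C^{(k₀)} ≥ C^{(k₀+1)} ≥ … ≥ 0` the increments `D_k ⪰ 0` have off-diagonal entries
dominated by HALF-DIAGONALS (2×2 minors, kernel `GAN24/MonotoneTraceNorm.norm_apply_le_half_diag`), the
diagonals telescope, and a telescoping Leibniz expansion of the product (ONE difference edge per term, the other
edges bounded by the trace of the head kernel) gives
  `Σ_{k ≥ k₀} |F(C^{(k)}) − F(C^{(k+1)})| ≤ |E|·(re tr C^{(k₀)})^{|E|}·Σ_x ‖w(x)‖`      (`tsum_norm_diagram_sub_le`)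
— bounded variation in the depth from printed-TYPE inputs only (a Löwner chain and ONE trace datum).  By
`NE7PairwiseMonotone.nullTail_of_summable_increments` (route ℓ¹'s currency ⟹ the null currency) every such
coefficient then has a NULL TAIL MODULUS `|F(C^{(j)}) − F_∞| ≤ c k → 0` (`j ≥ k`) with NO rate — the (α) «BV in
the depth» producer of ROUTE2 §2 T.5♭ ∕ `NE7PairwiseScaleShift.nullShift_of_split`, made available for every
Gaussian-sector source that is a finite diagram in a Löwner-monotone chain of unit-lattice covariances (§L2.2 B4
«PAYS: … every bridgeless diagram built from them»).

WHAT IS PROVED ([folklore]; `P : ℕ → Matrix n n ℂ`, `hstep : ∀ j ≥ k₀, (P j − P (j+1)).PosSemidef`,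
`hpos : ∀ j ≥ k₀, (P j).PosSemidef`; indices written `j + k₀`, so that `k₀ = 0` specialises definitionally).
§1 ENTRIES: `norm_apply_sub_succ_le`, `sum_norm_apply_sub_succ_le` (partial sums telescope against diagonals),
   `sum_norm_apply_sub_succ_le'` (≤ ½(re P k₀ a a + re P k₀ b b)), **`summable_norm_apply_sub_succ`**,
   `tsum_norm_apply_sub_succ_le`; `norm_apply_le_re_trace_head` (‖P j a b‖ ≤ re tr P k₀ for j ≥ k₀).
§2 PRODUCTS: `norm_prod_le_pow_card`, **`norm_prod_sub_prod_le_pow_mul_sum`** (telescoping Leibniz).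
§3 DIAGRAMS: `diagram src tgt w C := Σ_x w x · Π_e C (x (src e)) (x (tgt e))` (finite edge type `ε`, endpoint
   maps into a finite vertex-label type `ι`; multi-edges and self-loops allowed); `norm_diagram_sub_le`,
   **`sum_norm_diagram_sub_le`** (partial total variation ≤ |E|·γ^{|E|}·‖w‖₁, γ = re tr P k₀),
   **`summable_norm_diagram_sub`**, **`tsum_norm_diagram_sub_le`**.
§4 EXITS BY NAME: **`nullTail_re_diagram`** (through `NE7PairwiseMonotone.nullTail_of_summable_increments`),
   `cauchySeq_diagram`, `exists_tendsto_diagram` (the diagram values converge along the chain).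
§5 FIRST INSTANCE ON A TYPED BAŁABAN `U = 1` CONSTITUENT (non-vacuity witness, BY NAME on the β lane's GAN24
   chain): the transcribed Landau-gauge covariance fibre matrix `QGQ*^{(n)}(p′)` of [B5] (1.99)
   (`B5QGQ199Rate.qgq`, t4-ne2 lineage) is a Löwner chain along `n = Lc^j` (`MonotoneLoewner.posSemidef_qgq_pow_sub`,
   from asym1's `qform_qgq_anti`) of PSD matrices (`MonotoneLimit.posSemidef_qgq`) with head trace `≤ d·a⁻¹`
   (`re_trace_qgq_bounds`, printed (1.100)); hence **`summable_norm_diagram_qgq_sub`**,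
   **`tsum_norm_diagram_qgq_sub_le`** (TV ≤ |E|·(d·a⁻¹)^{|E|}·‖w‖₁ for EVERY diagram in its entries, every
   `a > 0`, `p′ ≠ 0`, `Lc ≥ 1`) and `nullTail_re_diagram_qgq` — an INSTANCE of the abstract lemma on a typed
   object, not a statement about Bałaban's position-space diagrams.

HONEST LIMITS.  (i) FINITE index set: the constants carry `Σ_x ‖w x‖` (a VOLUME factor for extensive sums) and
the TRACE of the head kernel; §L2.2 B3's refinement for INTENSIVE coefficients (2-edge-connected diagrams, printed
exponential decay, volume-UNIFORM constants) is NOT done here — at rung (B)+1 the unit torus is a fixed finite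
set; for infinite volume it would matter.  (ii) LÖW-res (§L2.2 B4: the one-loop coefficient `b₀(k)` is a
background-DERIVATIVE of `½ Tr log`, not a diagram in a monotone chain) and the sign rider LÖW-b₀(k) are untouched.
(iii) Beyond §5's fibre-matrix instance no Bałaban operator is instantiated; the position-space chains
(`MonotoneTorusPlaquette.plaqCov_antitone`, `MonotoneTorusTower`) are to be plugged in by their users.  NOT NE7
(spine 0/9 unchanged), NOT summit progress.  HONEST DEPENDENCY: continuum YM on T⁴ ⇐ BetaPertH ∧ nine spine
estimates (0/9 proved); BetaPertH ⇐ (D1) ∧ (D4) ∧ CAP+tail; G-an2-4 gates asym, D1 and NE2/3/4.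
-/

noncomputable section

open Finset Filter Topology
open scoped BigOperators ComplexOrder

namespace Summit.QuantumFields.BalabanUV.T4Continuum.NE7LoewnerDiagramBV

open Summit.QuantumFields.BalabanUV.Beta.GAN24.MonotoneLoewner
  (norm_apply_le_re_trace re_diag_nonneg re_diag_le_re_trace posSemidef_sub_of_steps)
open Summit.QuantumFields.BalabanUV.Beta.GAN24.MonotoneTraceNorm (norm_apply_le_half_diag)
open Summit.QuantumFields.BalabanUV.T4Continuum.NE7PairwiseMonotone (nullTail_of_summable_increments)

/-! ## §1 Entries of a Löwner chain have summable increments -/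

section Entries

variable {n : Type*} {P : ℕ → Matrix n n ℂ} {k₀ : ℕ}

/-- ONE STEP: the increment of the `(a,b)` entry is at most HALF THE SUM OF THE DIAGONAL DROPS at `a` and `b`
(the 2×2 minor of the PSD increment, `MonotoneTraceNorm.norm_apply_le_half_diag`). [folklore] -/
theorem norm_apply_sub_succ_le (hstep : ∀ j, k₀ ≤ j → (P j - P (j + 1)).PosSemidef) {j : ℕ} (hj : k₀ ≤ j)
    (a b : n) : ‖P j a b - P (j + 1) a b‖ ≤
      (((P j a a).re - (P (j + 1) a a).re) + ((P j b b).re - (P (j + 1) b b).re)) / 2 := by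
  have h := norm_apply_le_half_diag (hstep j hj) a b
  simpa [Matrix.sub_apply, Complex.sub_re] using h

/-- PARTIAL SUMS TELESCOPE: `Σ_{j<K} ‖P(j+k₀) a b − P(j+k₀+1) a b‖ ≤ ½[(re-diagonals at k₀) − (re-diagonals at K+k₀)]`.
[folklore] -/
theorem sum_norm_apply_sub_succ_le (hstep : ∀ j, k₀ ≤ j → (P j - P (j + 1)).PosSemidef) (a b : n) (K : ℕ) :
    ∑ j ∈ range K, ‖P (j + k₀) a b - P (j + k₀ + 1) a b‖ ≤
      (((P k₀ a a).re + (P k₀ b b).re) - ((P (K + k₀) a a).re + (P (K + k₀) b b).re)) / 2 := by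
  induction K with
  | zero => simp
  | succ K ih =>
    rw [sum_range_succ]
    have h := norm_apply_sub_succ_le hstep (Nat.le_add_left k₀ K) a b
    have e : K + 1 + k₀ = K + k₀ + 1 := Nat.add_right_comm K 1 k₀
    rw [e]
    linarith

/-- DEPTH-UNIFORM BOUND: with the chain members PSD, `Σ_{j<K} ‖P(j+k₀) a b − P(j+k₀+1) a b‖ ≤ ½(re P k₀ a a + re P k₀ b b)`
for every `K`. [folklore] -/
theorem sum_norm_apply_sub_succ_le' (hstep : ∀ j, k₀ ≤ j → (P j - P (j + 1)).PosSemidef)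
    (hpos : ∀ j, k₀ ≤ j → (P j).PosSemidef) (a b : n) (K : ℕ) :
    ∑ j ∈ range K, ‖P (j + k₀) a b - P (j + k₀ + 1) a b‖ ≤ ((P k₀ a a).re + (P k₀ b b).re) / 2 := by
  have h := sum_norm_apply_sub_succ_le hstep a b K
  have ha := re_diag_nonneg (hpos (K + k₀) (Nat.le_add_left _ _)) a
  have hb := re_diag_nonneg (hpos (K + k₀) (Nat.le_add_left _ _)) b
  linarith

/-- **EVERY ENTRY OF A LÖWNER CHAIN HAS SUMMABLE INCREMENTS** (bounded variation in the depth). [folklore] -/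
theorem summable_norm_apply_sub_succ (hstep : ∀ j, k₀ ≤ j → (P j - P (j + 1)).PosSemidef)
    (hpos : ∀ j, k₀ ≤ j → (P j).PosSemidef) (a b : n) :
    Summable fun j => ‖P (j + k₀) a b - P (j + k₀ + 1) a b‖ :=
  summable_of_sum_range_le (fun _ => norm_nonneg _) (sum_norm_apply_sub_succ_le' hstep hpos a b)

/-- … with total variation `≤ ½(re P k₀ a a + re P k₀ b b)`. [folklore] -/
theorem tsum_norm_apply_sub_succ_le (hstep : ∀ j, k₀ ≤ j → (P j - P (j + 1)).PosSemidef)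
    (hpos : ∀ j, k₀ ≤ j → (P j).PosSemidef) (a b : n) :
    ∑' j, ‖P (j + k₀) a b - P (j + k₀ + 1) a b‖ ≤ ((P k₀ a a).re + (P k₀ b b).re) / 2 :=
  Real.tsum_le_of_sum_range_le (fun _ => norm_nonneg _) (sum_norm_apply_sub_succ_le' hstep hpos a b)

variable [Fintype n]

/-- The head trace is nonnegative. [folklore] -/
theorem re_trace_head_nonneg (hpos : ∀ j, k₀ ≤ j → (P j).PosSemidef) : 0 ≤ (P k₀).trace.re := by
  have h := (hpos k₀ le_rfl).trace_nonneg
  rw [Complex.nonneg_iff] at h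
  simpa using h.1

/-- UNIFORM ENTRY BOUND along the chain: `‖P j a b‖ ≤ re tr (P k₀)` for all `j ≥ k₀` (entry ≤ own trace ≤ head trace).
[folklore] -/
theorem norm_apply_le_re_trace_head (hstep : ∀ j, k₀ ≤ j → (P j - P (j + 1)).PosSemidef)
    (hpos : ∀ j, k₀ ≤ j → (P j).PosSemidef) {j : ℕ} (hj : k₀ ≤ j) (a b : n) :
    ‖P j a b‖ ≤ (P k₀).trace.re := by
  have h1 := norm_apply_le_re_trace (hpos j hj) a b
  have h0 := (posSemidef_sub_of_steps hstep k₀ j le_rfl hj).trace_nonneg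
  rw [Complex.nonneg_iff, Matrix.trace_sub, Complex.sub_re] at h0
  linarith [h0.1]

/-- A diagonal real part is at most the head trace, along the chain. [folklore] -/
theorem re_diag_le_re_trace_head (hstep : ∀ j, k₀ ≤ j → (P j - P (j + 1)).PosSemidef)
    (hpos : ∀ j, k₀ ≤ j → (P j).PosSemidef) {j : ℕ} (hj : k₀ ≤ j) (a : n) :
    (P j a a).re ≤ (P k₀).trace.re := by
  have h1 := re_diag_le_re_trace (hpos j hj) a
  have h0 := (posSemidef_sub_of_steps hstep k₀ j le_rfl hj).trace_nonneg
  rw [Complex.nonneg_iff, Matrix.trace_sub, Complex.sub_re] at h0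
  linarith [h0.1]

end Entries

/-! ## §2 Products: uniform bound and the telescoping Leibniz estimate -/

section Products

variable {ε : Type*}

/-- `‖Π_s a‖ ≤ γ^{|s|}` when `‖a i‖ ≤ γ` on `s`. [folklore] -/
theorem norm_prod_le_pow_card (s : Finset ε) {a : ε → ℂ} {γ : ℝ} (ha : ∀ i ∈ s, ‖a i‖ ≤ γ) :
    ‖∏ i ∈ s, a i‖ ≤ γ ^ s.card := by
  calc ‖∏ i ∈ s, a i‖ ≤ ∏ i ∈ s, ‖a i‖ := norm_prod_le s a
    _ ≤ ∏ _i ∈ s, γ := prod_le_prod (fun i _ => norm_nonneg _) ha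
    _ = γ ^ s.card := prod_const γ

/-- **TELESCOPING LEIBNIZ**: `‖Π_s a − Π_s b‖ ≤ γ^{|s|−1}·Σ_{i∈s} ‖a i − b i‖` when `‖a i‖, ‖b i‖ ≤ γ` on `s` — one
difference factor per term, all other factors bounded by `γ`. [folklore] -/
theorem norm_prod_sub_prod_le_pow_mul_sum [DecidableEq ε] (s : Finset ε) {a b : ε → ℂ} {γ : ℝ} (hγ : 0 ≤ γ)
    (ha : ∀ i ∈ s, ‖a i‖ ≤ γ) (hb : ∀ i ∈ s, ‖b i‖ ≤ γ) :
    ‖∏ i ∈ s, a i - ∏ i ∈ s, b i‖ ≤ γ ^ (s.card - 1) * ∑ i ∈ s, ‖a i - b i‖ := by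
  induction s using Finset.induction_on with
  | empty => simp
  | insert j s hj ih =>
    have ha' : ∀ i ∈ s, ‖a i‖ ≤ γ := fun i hi => ha i (mem_insert_of_mem hi)
    have hb' : ∀ i ∈ s, ‖b i‖ ≤ γ := fun i hi => hb i (mem_insert_of_mem hi)
    have ih' := ih ha' hb'
    have haj := ha j (mem_insert_self j s)
    have hbj := hb j (mem_insert_self j s)
    have hPa : ‖∏ i ∈ s, a i‖ ≤ γ ^ s.card := norm_prod_le_pow_card s ha'
    have hS : 0 ≤ ∑ i ∈ s, ‖a i - b i‖ := sum_nonneg fun i _ => norm_nonneg _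
    rw [prod_insert hj, prod_insert hj, sum_insert hj, card_insert_of_notMem hj, Nat.add_sub_cancel]
    have hmid : γ * (γ ^ (s.card - 1) * ∑ i ∈ s, ‖a i - b i‖) ≤ γ ^ s.card * ∑ i ∈ s, ‖a i - b i‖ := by
      rcases s.eq_empty_or_nonempty with hs | hs
      · simp [hs]
      · have hc : s.card - 1 + 1 = s.card := Nat.sub_add_cancel (card_pos.mpr hs)
        rw [← mul_assoc, ← pow_succ', hc]
    have e1 : a j * ∏ i ∈ s, a i - b j * ∏ i ∈ s, b i =
        (a j - b j) * ∏ i ∈ s, a i + b j * (∏ i ∈ s, a i - ∏ i ∈ s, b i) := by ring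
    rw [e1]
    calc ‖(a j - b j) * ∏ i ∈ s, a i + b j * (∏ i ∈ s, a i - ∏ i ∈ s, b i)‖
        ≤ ‖a j - b j‖ * ‖∏ i ∈ s, a i‖ + ‖b j‖ * ‖∏ i ∈ s, a i - ∏ i ∈ s, b i‖ := by
          rw [← norm_mul, ← norm_mul]; exact norm_add_le _ _
      _ ≤ ‖a j - b j‖ * γ ^ s.card + γ * (γ ^ (s.card - 1) * ∑ i ∈ s, ‖a i - b i‖) :=
          add_le_add (mul_le_mul_of_nonneg_left hPa (norm_nonneg _))
            (mul_le_mul hbj ih' (norm_nonneg _) hγ)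
      _ ≤ ‖a j - b j‖ * γ ^ s.card + γ ^ s.card * ∑ i ∈ s, ‖a i - b i‖ := by linarith [hmid]
      _ = γ ^ s.card * (‖a j - b j‖ + ∑ i ∈ s, ‖a i - b i‖) := by ring

end Products

/-! ## §3 Diagrams along a Löwner chain: one step, partial total variation, summability -/

section Diagrams

variable {ε ι n : Type*} [Fintype ε] [DecidableEq ε] [Fintype ι] [DecidableEq ι] [Fintype n]

/-- A DIAGRAM FUNCTIONAL of a kernel `C`: edges `e : ε` with endpoints `src e, tgt e : ι` (vertex labels; multi-edges
and self-loops allowed), vertex positions `x : ι → n`, a position weight `w x` (the product of the local vertex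
functions, external legs, test functions …), value `Σ_x w x · Π_e C (x (src e)) (x (tgt e))` — the shape of every
Wick∕Feynman diagram in the entries of ONE covariance. [folklore] (our bookkeeping object; nothing printed) -/
def diagram (src tgt : ε → ι) (w : (ι → n) → ℂ) (C : Matrix n n ℂ) : ℂ :=
  ∑ x : ι → n, w x * ∏ e, C (x (src e)) (x (tgt e))

/-- ONE STEP: under a uniform entry bound `γ` on both kernels,
`‖F(C) − F(C′)‖ ≤ γ^{|E|−1} · Σ_x ‖w x‖ · Σ_e ‖C(x_{s(e)},x_{t(e)}) − C′(x_{s(e)},x_{t(e)})‖`. [folklore] -/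
theorem norm_diagram_sub_le (src tgt : ε → ι) (w : (ι → n) → ℂ) {C C' : Matrix n n ℂ} {γ : ℝ} (hγ : 0 ≤ γ)
    (hC : ∀ a b, ‖C a b‖ ≤ γ) (hC' : ∀ a b, ‖C' a b‖ ≤ γ) :
    ‖diagram src tgt w C - diagram src tgt w C'‖ ≤
      γ ^ (Fintype.card ε - 1) *
        ∑ x : ι → n, ‖w x‖ * ∑ e, ‖C (x (src e)) (x (tgt e)) - C' (x (src e)) (x (tgt e))‖ := by
  unfold diagram
  rw [← sum_sub_distrib, mul_sum]
  refine (norm_sum_le _ _).trans (sum_le_sum fun x _ => ?_)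
  rw [← mul_sub, norm_mul]
  have h := norm_prod_sub_prod_le_pow_mul_sum (univ : Finset ε) (a := fun e => C (x (src e)) (x (tgt e)))
    (b := fun e => C' (x (src e)) (x (tgt e))) hγ (fun e _ => hC _ _) (fun e _ => hC' _ _)
  rw [card_univ] at h
  calc ‖w x‖ * ‖∏ e, C (x (src e)) (x (tgt e)) - ∏ e, C' (x (src e)) (x (tgt e))‖
      ≤ ‖w x‖ * (γ ^ (Fintype.card ε - 1) * ∑ e, ‖C (x (src e)) (x (tgt e)) - C' (x (src e)) (x (tgt e))‖) :=
        mul_le_mul_of_nonneg_left h (norm_nonneg _)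
    _ = γ ^ (Fintype.card ε - 1) *
        (‖w x‖ * ∑ e, ‖C (x (src e)) (x (tgt e)) - C' (x (src e)) (x (tgt e))‖) := by ring

variable {P : ℕ → Matrix n n ℂ} {k₀ : ℕ}

/-- **PARTIAL TOTAL VARIATION OF A DIAGRAM ALONG A LÖWNER CHAIN**: `Σ_{j<K} ‖F(P(j+k₀)) − F(P(j+k₀+1))‖ ≤
|E|·γ^{|E|}·Σ_x ‖w x‖`, `γ = re tr P k₀` — one difference edge per Leibniz term (summable by §1 against
half-diagonals ≤ γ), the other `|E| − 1` edges bounded by γ. [folklore] -/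
theorem sum_norm_diagram_sub_le (hstep : ∀ j, k₀ ≤ j → (P j - P (j + 1)).PosSemidef)
    (hpos : ∀ j, k₀ ≤ j → (P j).PosSemidef) (src tgt : ε → ι) (w : (ι → n) → ℂ) (K : ℕ) :
    ∑ j ∈ range K, ‖diagram src tgt w (P (j + k₀)) - diagram src tgt w (P (j + k₀ + 1))‖ ≤
      (Fintype.card ε : ℝ) * (P k₀).trace.re ^ Fintype.card ε * ∑ x : ι → n, ‖w x‖ := by
  set γ : ℝ := (P k₀).trace.re with hγ_def
  have hγ : 0 ≤ γ := re_trace_head_nonneg hpos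
  -- (o) the exponent bookkeeping `|E|·γ^{|E|−1}·γ = |E|·γ^{|E|}` (both sides vanish when `|E| = 0`)
  have hpow : (Fintype.card ε : ℝ) * γ ^ (Fintype.card ε - 1) * γ = (Fintype.card ε : ℝ) * γ ^ Fintype.card ε := by
    rcases Nat.eq_zero_or_pos (Fintype.card ε) with h0 | hp
    · simp [h0]
    · rw [mul_assoc, ← pow_succ, Nat.sub_add_cancel hp]
  -- (i) one step, for each `j`
  have hj : ∀ j, ‖diagram src tgt w (P (j + k₀)) - diagram src tgt w (P (j + k₀ + 1))‖ ≤
      γ ^ (Fintype.card ε - 1) * ∑ x : ι → n, ‖w x‖ *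
        ∑ e, ‖P (j + k₀) (x (src e)) (x (tgt e)) - P (j + k₀ + 1) (x (src e)) (x (tgt e))‖ :=
    fun j => norm_diagram_sub_le src tgt w hγ
      (fun a b => norm_apply_le_re_trace_head hstep hpos (Nat.le_add_left k₀ j) a b)
      (fun a b => norm_apply_le_re_trace_head hstep hpos ((Nat.le_add_left k₀ j).trans (Nat.le_succ _)) a b)
  -- (ii) the entry increments sum, per edge, to at most half-diagonals ≤ γ
  have hent : ∀ (x : ι → n) (e : ε),
      ∑ j ∈ range K, ‖P (j + k₀) (x (src e)) (x (tgt e)) - P (j + k₀ + 1) (x (src e)) (x (tgt e))‖ ≤ γ := by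
    intro x e
    have h := sum_norm_apply_sub_succ_le' hstep hpos (x (src e)) (x (tgt e)) K
    have ha := re_diag_le_re_trace_head hstep hpos (le_refl k₀) (x (src e))
    have hb := re_diag_le_re_trace_head hstep hpos (le_refl k₀) (x (tgt e))
    linarith
  -- (iii) assemble: swap the sums
  calc ∑ j ∈ range K, ‖diagram src tgt w (P (j + k₀)) - diagram src tgt w (P (j + k₀ + 1))‖
      ≤ ∑ j ∈ range K, γ ^ (Fintype.card ε - 1) * ∑ x : ι → n, ‖w x‖ *
          ∑ e, ‖P (j + k₀) (x (src e)) (x (tgt e)) - P (j + k₀ + 1) (x (src e)) (x (tgt e))‖ :=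
        sum_le_sum fun j _ => hj j
    _ = γ ^ (Fintype.card ε - 1) * ∑ x : ι → n, ‖w x‖ * ∑ e, ∑ j ∈ range K,
          ‖P (j + k₀) (x (src e)) (x (tgt e)) - P (j + k₀ + 1) (x (src e)) (x (tgt e))‖ := by
        rw [← mul_sum, sum_comm]
        congr 1
        refine sum_congr rfl fun x _ => ?_
        rw [← mul_sum, sum_comm]
    _ ≤ γ ^ (Fintype.card ε - 1) * ∑ x : ι → n, ‖w x‖ * ∑ _e : ε, γ := by
        gcongr with x _ e _
        exact hent x e
    _ = (Fintype.card ε : ℝ) * γ ^ (Fintype.card ε - 1) * γ * ∑ x : ι → n, ‖w x‖ := by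
        simp only [sum_const, card_univ, ← sum_mul]
        ring
    _ = (Fintype.card ε : ℝ) * γ ^ Fintype.card ε * ∑ x : ι → n, ‖w x‖ := by rw [hpow]

/-- **THE DIAGRAM-BV LEMMA**: along a Löwner chain of PSD kernels every diagram functional has SUMMABLE INCREMENTS
(bounded variation in the depth). [folklore] -/
theorem summable_norm_diagram_sub (hstep : ∀ j, k₀ ≤ j → (P j - P (j + 1)).PosSemidef)
    (hpos : ∀ j, k₀ ≤ j → (P j).PosSemidef) (src tgt : ε → ι) (w : (ι → n) → ℂ) :
    Summable fun j => ‖diagram src tgt w (P (j + k₀)) - diagram src tgt w (P (j + k₀ + 1))‖ :=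
  summable_of_sum_range_le (fun _ => norm_nonneg _) (sum_norm_diagram_sub_le hstep hpos src tgt w)

/-- … with the explicit total-variation bound `Σ_j ‖ΔF‖ ≤ |E|·(re tr P k₀)^{|E|}·Σ_x ‖w x‖`. [folklore] -/
theorem tsum_norm_diagram_sub_le (hstep : ∀ j, k₀ ≤ j → (P j - P (j + 1)).PosSemidef)
    (hpos : ∀ j, k₀ ≤ j → (P j).PosSemidef) (src tgt : ε → ι) (w : (ι → n) → ℂ) :
    ∑' j, ‖diagram src tgt w (P (j + k₀)) - diagram src tgt w (P (j + k₀ + 1))‖ ≤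
      (Fintype.card ε : ℝ) * (P k₀).trace.re ^ Fintype.card ε * ∑ x : ι → n, ‖w x‖ :=
  Real.tsum_le_of_sum_range_le (fun _ => norm_nonneg _) (sum_norm_diagram_sub_le hstep hpos src tgt w)

end Diagrams

/-! ## §4 Exits by name: null tail modulus (route ℓ¹ ⟹ null currency), Cauchy, limit -/

section Exits

variable {ε ι n : Type*} [Fintype ε] [DecidableEq ε] [Fintype ι] [DecidableEq ι] [Fintype n]
variable {P : ℕ → Matrix n n ℂ} {k₀ : ℕ}

/-- **NULL TAIL MODULUS FOR THE REAL PART OF A DIAGRAM, NO RATE** — the (α) «BV in the depth» producer of ROUTE2 §2 T.5♭: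
through `NE7PairwiseMonotone.nullTail_of_summable_increments`, `∃ F_∞ c, (∀ k ≤ j, |re F(P(j+k₀)) − F_∞| ≤ c k) ∧ c → 0`.
[folklore] -/
theorem nullTail_re_diagram (hstep : ∀ j, k₀ ≤ j → (P j - P (j + 1)).PosSemidef)
    (hpos : ∀ j, k₀ ≤ j → (P j).PosSemidef) (src tgt : ε → ι) (w : (ι → n) → ℂ) :
    ∃ Finf : ℝ, ∃ c : ℕ → ℝ,
      (∀ k j, k ≤ j → |(diagram src tgt w (P (j + k₀))).re - Finf| ≤ c k) ∧ Tendsto c atTop (𝓝 0) := by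
  refine nullTail_of_summable_increments ?_
  refine (summable_norm_diagram_sub hstep hpos src tgt w).of_nonneg_of_le (fun _ => abs_nonneg _) fun j => ?_
  have e : j + 1 + k₀ = j + k₀ + 1 := Nat.add_right_comm j 1 k₀
  rw [abs_sub_comm, ← Complex.sub_re, e]
  exact Complex.abs_re_le_norm _

/-- The diagram values form a CAUCHY sequence along the chain. [folklore] -/
theorem cauchySeq_diagram (hstep : ∀ j, k₀ ≤ j → (P j - P (j + 1)).PosSemidef)
    (hpos : ∀ j, k₀ ≤ j → (P j).PosSemidef) (src tgt : ε → ι) (w : (ι → n) → ℂ) :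
    CauchySeq fun j => diagram src tgt w (P (j + k₀)) := by
  refine cauchySeq_of_dist_le_of_summable _ (fun j => ?_) (summable_norm_diagram_sub hstep hpos src tgt w)
  rw [dist_eq_norm]
  have e : j + 1 + k₀ = j + k₀ + 1 := Nat.add_right_comm j 1 k₀
  rw [Nat.succ_eq_add_one, e]

/-- … hence CONVERGE (ℂ is complete): the depth-`∞` value of the diagram exists. [folklore] -/
theorem exists_tendsto_diagram (hstep : ∀ j, k₀ ≤ j → (P j - P (j + 1)).PosSemidef)
    (hpos : ∀ j, k₀ ≤ j → (P j).PosSemidef) (src tgt : ε → ι) (w : (ι → n) → ℂ) :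
    ∃ Finf : ℂ, Tendsto (fun j => diagram src tgt w (P (j + k₀))) atTop (𝓝 Finf) :=
  cauchySeq_tendsto_of_complete (cauchySeq_diagram hstep hpos src tgt w)

end Exits

/-! ## §5 First instance on a typed Bałaban `U = 1` constituent: the (1.99) covariance fibre `QGQ*^{(Lc^j)}(p′)` -/

section QGQ

open Literature.MathematicalPhysics.QuantumFieldTheory.Balaban1983to89.B5QGQ199Rate (qgq)
open Summit.QuantumFields.BalabanUV.Beta.GAN24.MonotoneLoewner (posSemidef_qgq_pow_sub re_trace_qgq_bounds)
open Summit.QuantumFields.BalabanUV.Beta.GAN24.MonotoneLimit (posSemidef_qgq)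
open scoped Real

variable {d : ℕ} {ε ι : Type*} [Fintype ε] [DecidableEq ε] [Fintype ι] [DecidableEq ι]

/-- **EVERY DIAGRAM IN THE ENTRIES OF `QGQ*^{(Lc^j)}(p′)` HAS SUMMABLE INCREMENTS IN THE DEPTH `j`** (`a > 0`, `p′ ≠ 0`,
any block size `Lc ≥ 1`): §3 on the GAN24 Löwner chain `posSemidef_qgq_pow_sub` ∕ `posSemidef_qgq`. [folklore] -/
theorem summable_norm_diagram_qgq_sub (Lc : ℕ) [NeZero Lc] (a : ℝ) (ha : 0 < a) (s : Fin d → ℝ)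
    (hs : ∀ κ, |s κ| ≤ π) (ν₀ : Fin d) (hν₀ : s ν₀ ≠ 0) (src tgt : ε → ι) (w : (ι → Fin d) → ℂ) :
    Summable fun j => ‖diagram src tgt w (qgq (Lc ^ j) a s) - diagram src tgt w (qgq (Lc ^ (j + 1)) a s)‖ := by
  have h := summable_norm_diagram_sub (P := fun j => qgq (Lc ^ j) a s) (k₀ := 0)
    (fun j _ => posSemidef_qgq_pow_sub Lc a ha.le s hs ν₀ hν₀ j 1)
    (fun j _ => posSemidef_qgq (Lc ^ j) (Nat.one_le_iff_ne_zero.mpr (NeZero.ne _)) a ha s hs ν₀ hν₀) src tgt w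
  exact h

/-- … with TOTAL VARIATION `≤ |E|·(d·a⁻¹)^{|E|}·Σ_x ‖w x‖` (head trace `re tr QGQ*^{(1)}(p′) ≤ d·a⁻¹`, printed (1.100)).
[folklore] -/
theorem tsum_norm_diagram_qgq_sub_le (Lc : ℕ) [NeZero Lc] (a : ℝ) (ha : 0 < a) (s : Fin d → ℝ)
    (hs : ∀ κ, |s κ| ≤ π) (ν₀ : Fin d) (hν₀ : s ν₀ ≠ 0) (src tgt : ε → ι) (w : (ι → Fin d) → ℂ) :
    ∑' j, ‖diagram src tgt w (qgq (Lc ^ j) a s) - diagram src tgt w (qgq (Lc ^ (j + 1)) a s)‖ ≤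
      (Fintype.card ε : ℝ) * ((d : ℝ) * a⁻¹) ^ Fintype.card ε * ∑ x : ι → Fin d, ‖w x‖ := by
  have h := tsum_norm_diagram_sub_le (P := fun j => qgq (Lc ^ j) a s) (k₀ := 0)
    (fun j _ => posSemidef_qgq_pow_sub Lc a ha.le s hs ν₀ hν₀ j 1)
    (fun j _ => posSemidef_qgq (Lc ^ j) (Nat.one_le_iff_ne_zero.mpr (NeZero.ne _)) a ha s hs ν₀ hν₀) src tgt w
  have ht := re_trace_qgq_bounds (Lc ^ 0) (Nat.one_le_iff_ne_zero.mpr (NeZero.ne _)) a ha s hs ν₀ hν₀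
  exact h.trans (mul_le_mul_of_nonneg_right
    (mul_le_mul_of_nonneg_left (pow_le_pow_left₀ ht.1 ht.2 _) (Nat.cast_nonneg _))
    (sum_nonneg fun _ _ => norm_nonneg _))

/-- … hence a NULL TAIL MODULUS, no rate, for the real part of every such diagram. [folklore] -/
theorem nullTail_re_diagram_qgq (Lc : ℕ) [NeZero Lc] (a : ℝ) (ha : 0 < a) (s : Fin d → ℝ)
    (hs : ∀ κ, |s κ| ≤ π) (ν₀ : Fin d) (hν₀ : s ν₀ ≠ 0) (src tgt : ε → ι) (w : (ι → Fin d) → ℂ) :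
    ∃ Finf : ℝ, ∃ c : ℕ → ℝ,
      (∀ k j, k ≤ j → |(diagram src tgt w (qgq (Lc ^ j) a s)).re - Finf| ≤ c k) ∧ Tendsto c atTop (𝓝 0) := by
  have h := nullTail_re_diagram (P := fun j => qgq (Lc ^ j) a s) (k₀ := 0)
    (fun j _ => posSemidef_qgq_pow_sub Lc a ha.le s hs ν₀ hν₀ j 1)
    (fun j _ => posSemidef_qgq (Lc ^ j) (Nat.one_le_iff_ne_zero.mpr (NeZero.ne _)) a ha s hs ν₀ hν₀) src tgt w
  exact h

end QGQ

end Summit.QuantumFields.BalabanUV.T4Continuum.NE7LoewnerDiagramBV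

end
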